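import Literature.Probability.RandomPlanarGeometry.SAWCountZdSymbolTopCount
import HarnessLib

/-!
# ONE-BLOCK SHAPE CLASSES ↔ SET PARTITIONS OF THE FREE POSITIONS: `#shapeClass j m (topVec m p) = #goodParts · 2^{m−2}` for every `m`

Topic `Literature/Probability/RandomPlanarGeometry` (the «SYMBOL POLYNOMIALITY» programme; generalises car λ (a-p1 g25): λ1 `SAWCountZdSymbolTopShapes.lean`
(`topVec`, `axCls`, `exists_opp_in_block`, `top_block` for `m = 2j`), λ2 `SAWCountZdSymbolTopData.lean` (`InB`, `outside`, `freePos`, `signOf`, `mkWord`), λ3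
`SAWCountZdSymbolTopCount.lean` (`signsOf`, `axCls_canon`, `card_freePos`, `card_shapeClass_top`); set partitions `IsSetPartition` / `setPartitions` / `blockOf` of
`Literature/Probability/LatticeModels/HardCoreUrsell.lean`).

PRINTED CONTEXT (locators only; nothing is quoted digit-for-digit). Madras–Slade (1993) §1.1 eq. (1.1.8) p. 5, Definition 1.2.4, §1.2 p. 10; Clisby–Liang–Slade (2007)
§3.3 eqs. (29)/(31). NOT IN PRINT as far as the lane's desks could locate: the statements below (lane theorems about the lane's shape classes).

THE THEOREM. A ONE-BLOCK shape class `shapeClass j m (topVec m p)` (adjacencies exactly at `p, p+1, p+2`; these are ALL the classes with `m − 3` breaks, λ1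
`exists_eq_topVec_of_mem_shapeClass`) consists of the canonical words `κ` of length `m` on `m − j` axes, every position repeated, whose block `[p, p+4)` reads
`x y x̄ ȳ` — ★ `top_block_general`: this holds for EVERY `m` (λ1 proved it for `m = 2j` via "every axis twice"; here from run-wise reversal-freeness and the zero
block alone). HENCE THE DATA OF `κ` IS: the set partition of the `m − 2` FREE positions (all but `p+2`, `p+3`, whose letters are forced) by axis, and the signs on
the free positions; the partition is GOOD: `p ≁ p+1`, every block avoiding `p, p+1` has `≥ 2` elements (repeats), and there are `m − j` blocks (axes). Conversely
every good partition `π` with a sign set `S` builds a class member `canon (mkWordP π S)` (axis of `q` = least element of the block of its base point, `p+2 ↦ p`,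
`p+3 ↦ p+1`). ★★ `card_shapeClass_topVec_eq_card_blockData` (the two maps are inverse: `canon_mkWordP_partOf_signsOf`, `partOf_signsOf_canon_mkWordP`) and
★★★ `card_shapeClass_topVec`: **`#shapeClass j m (topVec m p) = #goodParts m j p · 2^{m−2}`** for all `m, j, p` (`p + 4 ≤ m`). INSTANCES: `m = 2j` — good =
`{p}, {p+1}` + a perfect matching of the `2j − 4` outside positions (λ3: `(2j−5)‼·2^{2j−2}`); `m = 2j − 1` (the SECOND-LAYER lower corner `V'_j` of
`SAWCountZdSymbolSecondCoefficient.lean`) — good = one outside triple + pairs, or `p`/`p+1` joined to one outside position + pairs: `(2j−5)‼(j+3)/3` per `p` (counted in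
the sequel); `m = 2j − 2` (a third-layer corner) likewise.
Tool notions (the lane's): `basePt`, `axisOfP`, `mkWordP`, `GoodPart`, `goodParts`, `blockData`, `partOf`.

THIS FILE (lane «pcv-sawmu», a-p1 g26; all PROVED, standard axioms): ★ `top_block_general`, `basePt`, `basePt_mem_freePos`, `basePt_of_mem_freePos`, `basePt_block`,
`axisOfP`, `mkWordP`, ★ `axisOfP_eq_iff`, `axCls_mkWordP`, `blockOf_eq_of_mem_blockOf`, `GoodPart`, `goodParts`, `blockData`, `numAxes_mkWordP`, `isRep_mkWordP`, `bsumW_mkWordP`,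
★ `canon_mkWordP_mem_shapeClass`, `partOf`, `isSetPartition_partOf`, `blockOf_partOf`, `axis_basePt`, ★ `partOf_signsOf_mem_blockData`, ★ `canon_mkWordP_partOf_signsOf`,
★ `partOf_signsOf_canon_mkWordP`, ★★ `card_shapeClass_topVec_eq_card_blockData`, ★★★ `card_shapeClass_topVec`.
[cite: MadrasSlade1993, §1.1 eq. (1.1.8) p. 5; Definition 1.2.4; §1.2 (p. 10)] [cite: ClisbyLiangSlade2007, §3.3 eqs. (29)/(31)]

Provenance: lane «pcv-sawmu», a-p1 g26 (2026-08-28).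
-/

open Finset
open scoped BigOperators
open Literature.Probability.LatticeModels
open Literature.Probability.RandomPlanarGeometry.SAW
open Literature.Probability.Percolation

namespace Literature.Probability.RandomPlanarGeometry.SAW.Zd

namespace WordTypes

variable {m : ℕ} {p : ℕ}

/-! ### The block of a one-block class reads `x y x̄ ȳ` — for every `m` (λ1's `top_block` without the all-pairs hypothesis) -/

/-- ★ For `κ ∈ shapeClass j m (topVec m p)` (any `m`): the letters at `p+2`, `p+3` are the opposites of those at `p`, `p+1`, and the two block axes differ.
Only run-wise reversal-freeness and the zero block are used. [cite: MadrasSlade1993, Definition 1.2.4; lane lemma] -/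
theorem top_block_general {j : ℕ} {κ : Word m m} (hκ : κ ∈ shapeClass j m (topVec m p)) (hp4 : p + 4 ≤ m) :
    κ ⟨p + 2, by omega⟩ = ((κ ⟨p, by omega⟩).1, !(κ ⟨p, by omega⟩).2) ∧
      κ ⟨p + 3, by omega⟩ = ((κ ⟨p + 1, by omega⟩).1, !(κ ⟨p + 1, by omega⟩).2) ∧
        (κ ⟨p, by omega⟩).1 ≠ (κ ⟨p + 1, by omega⟩).1 := by
  have hnr : RunNoRev (topVec m p) κ := by
    unfold shapeClass at hκ
    simp only [Finset.mem_filter, Finset.mem_univ, true_and] at hκ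
    exact hκ.2.2.2.1
  have nr : ∀ i (hi : i + 1 < m), p ≤ i → i ≤ p + 2 →
      κ ⟨i + 1, hi⟩ ≠ ((κ ⟨i, by omega⟩).1, !(κ ⟨i, by omega⟩).2) :=
    fun i hi h1 h2 => hnr ⟨i, by omega⟩ hi ((topVec_eq_true_iff _).2 ⟨h1, h2⟩)
  have hopp : ∀ (a b : Fin m), κ b = ((κ a).1, !(κ a).2) → κ a = ((κ b).1, !(κ b).2) := by
    intro a b h; rw [h]; simp
  -- the opposite of the letter at `p+1` sits at `r ∈ {p, p+2, p+3}`; `r = p` and `r = p+2` are reversals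
  obtain ⟨r, hrt, hrne, hr⟩ := exists_opp_in_block hκ ⟨p + 1, by omega⟩ ⟨by simp only; omega, by simp only; omega⟩
  have hrp : r.val ≠ p := by
    intro h
    have hr' : r = ⟨p, by omega⟩ := Fin.ext h
    rw [hr'] at hr
    exact nr p (by omega) le_rfl (by omega) (hopp _ _ hr)
  have hr2 : r.val ≠ p + 2 := by
    intro h
    have hr' : r = ⟨p + 2, by omega⟩ := Fin.ext h
    exact nr (p + 1) (by omega) (by omega) (by omega) (by rw [← hr']; exact hr)
  have hr1 : r.val ≠ p + 1 := fun h => hrne (Fin.ext h)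
  have hr3 : r = ⟨p + 3, by omega⟩ := Fin.ext (by have h1 := hrt.1; have h2 := hrt.2; simp only at h1 h2 ⊢; omega)
  rw [hr3] at hr
  -- the opposite of the letter at `p` sits at `q ∈ {p+1, p+2, p+3}`; `q = p+1` is a reversal; `q = p+3` forces `κ p = κ (p+1)` and then a reversal at `(p+1, p+2)`
  obtain ⟨q, hqt, hqne, hq⟩ := exists_opp_in_block hκ ⟨p, by omega⟩ ⟨le_rfl, by simp only; omega⟩
  have hq1 : q.val ≠ p + 1 := by
    intro h
    have hq' : q = ⟨p + 1, by omega⟩ := Fin.ext h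
    exact nr p (by omega) le_rfl (by omega) (by rw [← hq']; exact hq)
  have hq3 : q.val ≠ p + 3 := by
    intro h
    have hq' : q = ⟨p + 3, by omega⟩ := Fin.ext h
    rw [hq'] at hq
    -- `κ p = κ (p+1)`
    have hpp : κ ⟨p, by omega⟩ = κ ⟨p + 1, by omega⟩ := by
      have := hq.symm.trans hr
      obtain ⟨h1, h2⟩ := Prod.mk.inj this
      exact Prod.ext h1 (by simpa using h2)
    -- the block sums to zero: the letter at `p+2` then is the opposite of `κ p`
    obtain ⟨q2, hq2t, hq2ne, hq2⟩ := exists_opp_in_block hκ ⟨p + 2, by omega⟩ ⟨by simp only; omega, by simp only; omega⟩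
    -- `q2 ∈ {p, p+1, p+3}`; `p+1`/`p+3` adjacent reversals; `q2 = p`: then κ(p+2) = opp κ p = opp κ(p+1): reversal at (p+1,p+2)
    have hq2v : q2.val = p ∨ q2.val = p + 1 ∨ q2.val = p + 3 := by
      have h1 := hq2t.1; have h2 := hq2t.2; have h3 : q2.val ≠ p + 2 := fun h => hq2ne (Fin.ext h)
      omega
    rcases hq2v with h | h | h
    · have hq2' : q2 = ⟨p, by omega⟩ := Fin.ext h
      rw [hq2'] at hq2
      have : κ ⟨p + 2, by omega⟩ = ((κ ⟨p + 1, by omega⟩).1, !(κ ⟨p + 1, by omega⟩).2) := by rw [← hpp]; exact hopp _ _ hq2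
      exact nr (p + 1) (by omega) (by omega) (by omega) this
    · have hq2' : q2 = ⟨p + 1, by omega⟩ := Fin.ext h
      rw [hq2'] at hq2
      exact nr (p + 1) (by omega) (by omega) (by omega) (hopp _ _ hq2)
    · have hq2' : q2 = ⟨p + 3, by omega⟩ := Fin.ext h
      rw [hq2'] at hq2
      exact nr (p + 2) (by omega) (by omega) (by omega) hq2
  have hq0 : q.val ≠ p := fun h => hqne (Fin.ext h)
  have hq2 : q = ⟨p + 2, by omega⟩ := Fin.ext (by have h1 := hqt.1; have h2 := hqt.2; simp only at h1 h2 ⊢; omega)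
  rw [hq2] at hq
  refine ⟨hq, hr, fun hax => ?_⟩
  -- same axis at `p`, `p+1`: same sign is `κ p = κ (p+1)` ⇒ κ(p+2) = opp κ(p+1): reversal; opposite sign: reversal at (p, p+1)
  by_cases hs : (κ ⟨p, by omega⟩).2 = (κ ⟨p + 1, by omega⟩).2
  · have hpp : κ ⟨p, by omega⟩ = κ ⟨p + 1, by omega⟩ := Prod.ext hax hs
    exact nr (p + 1) (by omega) (by omega) (by omega) (by rw [← hpp]; exact hq)
  · apply nr p (by omega) le_rfl (by omega)
    refine Prod.ext hax.symm ?_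
    simp only
    cases h1 : (κ ⟨p, by omega⟩).2 <;> cases h2 : (κ ⟨p + 1, by omega⟩).2 <;> simp_all

/-! ### The base point and the built word of a set partition of the free positions -/

/-- The BASE POINT: `p+2 ↦ p`, `p+3 ↦ p+1`, every other position to itself. [cite: MadrasSlade1993, Definition 1.2.4; lane tool notion] -/
def basePt (hp : p + 4 ≤ m) (q : Fin m) : Fin m :=
  if q.val = p + 2 then ⟨p, by omega⟩ else if q.val = p + 3 then ⟨p + 1, by omega⟩ else q

/-- The base point is a free position. [cite: MadrasSlade1993, Definition 1.2.4; lane plumbing] -/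
theorem basePt_mem_freePos (hp : p + 4 ≤ m) (q : Fin m) : basePt hp q ∈ freePos m p := by
  unfold basePt freePos
  rw [Finset.mem_filter]
  refine ⟨Finset.mem_univ _, ?_⟩
  split_ifs with h1 h2
  · simp
  · simp
  · exact ⟨h1, h2⟩

/-- On free positions the base point is the identity. [cite: MadrasSlade1993, Definition 1.2.4; lane plumbing] -/
theorem basePt_of_mem_freePos (hp : p + 4 ≤ m) {q : Fin m} (hq : q ∈ freePos m p) : basePt hp q = q := by
  unfold freePos at hq
  rw [Finset.mem_filter] at hq
  unfold basePt
  rw [if_neg hq.2.1, if_neg hq.2.2]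

/-- `basePt (p+2) = p`, `basePt (p+3) = p+1`, `basePt p = p`, `basePt (p+1) = p+1`. [cite: MadrasSlade1993, Definition 1.2.4; lane plumbing] -/
theorem basePt_block (hp : p + 4 ≤ m) :
    basePt hp ⟨p + 2, by omega⟩ = ⟨p, by omega⟩ ∧ basePt hp ⟨p + 3, by omega⟩ = ⟨p + 1, by omega⟩ ∧
      basePt hp ⟨p, by omega⟩ = ⟨p, by omega⟩ ∧ basePt hp ⟨p + 1, by omega⟩ = ⟨p + 1, by omega⟩ := by
  unfold basePt
  refine ⟨by simp, by simp, by simp, by simp⟩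

open Classical in
/-- The axis of position `q` in the word built from a set partition `π` of the free positions: the least element of the block of its base point.
[cite: MadrasSlade1993, Definition 1.2.4; lane tool notion] -/
noncomputable def axisOfP (hp : p + 4 ≤ m) (π : Finset (Finset (Fin m))) (q : Fin m) : Fin m :=
  if h : (blockOf π (basePt hp q)).Nonempty then (blockOf π (basePt hp q)).min' h else q

/-- The word of a (set partition, sign set) datum (before canonical renaming; signs as in λ2's `signOf`).
[cite: MadrasSlade1993, Definition 1.2.4; lane tool notion] -/
noncomputable def mkWordP (hp : p + 4 ≤ m) (π : Finset (Finset (Fin m))) (S : Finset (Fin m)) : Word m m :=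
  fun q => (axisOfP hp π q, signOf hp S q)

/-- ★ THE AXIS RELATION OF `mkWordP`: two positions share an axis iff their base points lie in the same block.
[cite: MadrasSlade1993, Definition 1.2.4; lane lemma] -/
theorem axisOfP_eq_iff (hp : p + 4 ≤ m) {π : Finset (Finset (Fin m))} (hπ : IsSetPartition (freePos m p) π) (q q' : Fin m) :
    axisOfP hp π q = axisOfP hp π q' ↔ blockOf π (basePt hp q) = blockOf π (basePt hp q') := by
  have hne : ∀ r : Fin m, (blockOf π (basePt hp r)).Nonempty := fun r => ⟨_, hπ.mem_blockOf (basePt_mem_freePos hp r)⟩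
  have e : ∀ r : Fin m, axisOfP hp π r = (blockOf π (basePt hp r)).min' (hne r) := by
    intro r; unfold axisOfP; rw [dif_pos (hne r)]
  rw [e q, e q']
  constructor
  · intro h
    have h1 : (blockOf π (basePt hp q)).min' (hne q) ∈ blockOf π (basePt hp q) := Finset.min'_mem _ _
    have h2 : (blockOf π (basePt hp q')).min' (hne q') ∈ blockOf π (basePt hp q') := Finset.min'_mem _ _
    rw [h] at h1
    exact hπ.eq_of_mem (hπ.blockOf_mem (basePt_mem_freePos hp q)) (hπ.blockOf_mem (basePt_mem_freePos hp q')) h1 h2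
  · intro h; simp only [h]

open Classical in
/-- The axis classes of `mkWordP`: the positions whose base points share the block. [cite: MadrasSlade1993, Definition 1.2.4; lane lemma] -/
theorem axCls_mkWordP (hp : p + 4 ≤ m) {π : Finset (Finset (Fin m))} (hπ : IsSetPartition (freePos m p) π) (S : Finset (Fin m)) (q : Fin m) :
    axCls (mkWordP hp π S) q = Finset.univ.filter fun r => blockOf π (basePt hp r) = blockOf π (basePt hp q) := by
  ext r
  rw [mem_axCls, Finset.mem_filter]
  change axisOfP hp π r = axisOfP hp π q ↔ _
  rw [axisOfP_eq_iff hp hπ]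
  simp

/-- A free position in the block of a base point has the same axis. [cite: MadrasSlade1993, Definition 1.2.4; lane plumbing] -/
theorem blockOf_eq_of_mem_blockOf (hp : p + 4 ≤ m) {π : Finset (Finset (Fin m))} (hπ : IsSetPartition (freePos m p) π)
    {q r : Fin m} (hr : r ∈ blockOf π (basePt hp q)) : blockOf π (basePt hp r) = blockOf π (basePt hp q) := by
  have hB := hπ.blockOf_mem (basePt_mem_freePos hp q)
  have hrF : r ∈ freePos m p := hπ.subset hB hr
  rw [basePt_of_mem_freePos hp hrF]
  exact hπ.eq_blockOf hB hr

/-! ### The good partitions and the block data -/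

/-- A GOOD partition of the free positions for `shapeClass j m (topVec m p)`: `p` and `p+1` in different blocks, every block avoiding `p` and `p+1`
has at least two elements, and `m − j` blocks. [cite: MadrasSlade1993, Definition 1.2.4; lane tool notion] -/
def GoodPart (m j p : ℕ) (hp : p + 4 ≤ m) (π : Finset (Finset (Fin m))) : Prop :=
  blockOf π (⟨p, by omega⟩ : Fin m) ≠ blockOf π ⟨p + 1, by omega⟩ ∧
    (∀ B ∈ π, (⟨p, by omega⟩ : Fin m) ∉ B → (⟨p + 1, by omega⟩ : Fin m) ∉ B → 2 ≤ B.card) ∧ π.card + j = m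

open Classical in
/-- The good partitions. [cite: MadrasSlade1993, Definition 1.2.4; lane tool notion] -/
noncomputable def goodParts (m j p : ℕ) (hp : p + 4 ≤ m) : Finset (Finset (Finset (Fin m))) :=
  (setPartitions (freePos m p)).filter (GoodPart m j p hp)

open Classical in
/-- The BLOCK DATA: good partitions × sign sets on the free positions. [cite: MadrasSlade1993, Definition 1.2.4; lane tool notion] -/
noncomputable def blockData (m j p : ℕ) (hp : p + 4 ≤ m) : Finset (Finset (Finset (Fin m)) × Finset (Fin m)) :=
  goodParts m j p hp ×ˢ (freePos m p).powerset

/-! ### Membership: the built word of a good datum is in the class -/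

/-- The number of axes of `mkWordP` is the number of blocks. [cite: MadrasSlade1993, Definition 1.2.4; lane lemma] -/
theorem numAxes_mkWordP (hp : p + 4 ≤ m) {π : Finset (Finset (Fin m))} (hπ : IsSetPartition (freePos m p) π) (S : Finset (Fin m)) :
    numAxes (mkWordP hp π S) = π.card := by
  classical
  rw [numAxes_eq_card_image]
  change (Finset.univ.image fun q => axisOfP hp π q).card = π.card
  have hne : ∀ r : Fin m, (blockOf π (basePt hp r)).Nonempty := fun r => ⟨_, hπ.mem_blockOf (basePt_mem_freePos hp r)⟩
  have e : ∀ r : Fin m, axisOfP hp π r = (blockOf π (basePt hp r)).min' (hne r) := by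
    intro r; unfold axisOfP; rw [dif_pos (hne r)]
  -- the image of `axisOfP` is the image of `min'` over the blocks
  have himg : (Finset.univ.image fun q => axisOfP hp π q) = π.attach.image fun B => B.1.min' (hπ.nonempty_of_mem B.2) := by
    ext a
    simp only [Finset.mem_image, Finset.mem_univ, true_and, Finset.mem_attach]
    constructor
    · rintro ⟨q, rfl⟩
      refine ⟨⟨blockOf π (basePt hp q), hπ.blockOf_mem (basePt_mem_freePos hp q)⟩, ?_⟩
      rw [e q]
    · rintro ⟨⟨B, hB⟩, rfl⟩
      obtain ⟨v, hv⟩ := hπ.nonempty_of_mem hB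
      refine ⟨v, ?_⟩
      rw [e v]
      have hvF : v ∈ freePos m p := hπ.subset hB hv
      simp only [basePt_of_mem_freePos hp hvF, hπ.eq_blockOf hB hv]
  rw [himg, Finset.card_image_of_injOn, Finset.card_attach]
  rintro ⟨B, hB⟩ - ⟨B', hB'⟩ - h
  simp only at h
  have h1 : B.min' (hπ.nonempty_of_mem hB) ∈ B := Finset.min'_mem _ _
  have h2 : B'.min' (hπ.nonempty_of_mem hB') ∈ B' := Finset.min'_mem _ _
  rw [h] at h1
  exact Subtype.ext (hπ.eq_of_mem hB hB' h1 h2)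

/-- Every position of `mkWordP` is repeated, for a good partition. [cite: MadrasSlade1993, Definition 1.2.4; lane lemma] -/
theorem isRep_mkWordP {j : ℕ} (hp : p + 4 ≤ m) {π : Finset (Finset (Fin m))} (hπ : IsSetPartition (freePos m p) π) (hg : GoodPart m j p hp π)
    (S : Finset (Fin m)) (q : Fin m) : IsRep (mkWordP hp π S) q := by
  classical
  -- it suffices to find `r ≠ q` with the same block of base points
  suffices h : ∃ r : Fin m, r ≠ q ∧ blockOf π (basePt hp r) = blockOf π (basePt hp q) by
    obtain ⟨r, hr, hb⟩ := h
    refine ⟨r, hr, ?_⟩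
    change axisOfP hp π r = axisOfP hp π q
    rw [axisOfP_eq_iff hp hπ, hb]
  obtain ⟨b2, b3, b0, b1⟩ := basePt_block hp
  by_cases h2 : q.val = p + 2
  · have hbq : basePt hp q = ⟨p, by omega⟩ := by unfold basePt; rw [if_pos h2]
    exact ⟨⟨p, by omega⟩, fun h => by have := congrArg Fin.val h; simp only at this; omega, by rw [b0, hbq]⟩
  by_cases h3 : q.val = p + 3
  · have hbq : basePt hp q = ⟨p + 1, by omega⟩ := by unfold basePt; rw [if_neg h2, if_pos h3]
    exact ⟨⟨p + 1, by omega⟩, fun h => by have := congrArg Fin.val h; simp only at this; omega, by rw [b1, hbq]⟩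
  have hbq : basePt hp q = q := by unfold basePt; rw [if_neg h2, if_neg h3]
  by_cases h0 : q.val = p
  · refine ⟨⟨p + 2, by omega⟩, fun h => by have := congrArg Fin.val h; simp only at this; omega, ?_⟩
    rw [b2, hbq]; congr 1; exact Fin.ext (by simp only; omega)
  by_cases h1 : q.val = p + 1
  · refine ⟨⟨p + 3, by omega⟩, fun h => by have := congrArg Fin.val h; simp only at this; omega, ?_⟩
    rw [b3, hbq]; congr 1; exact Fin.ext (by simp only; omega)
  -- a genuine outside position: its block avoids `p`, `p+1` or contains one of them
  have hqF : q ∈ freePos m p := by unfold freePos; rw [Finset.mem_filter]; exact ⟨Finset.mem_univ _, h2, h3⟩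
  rw [basePt_of_mem_freePos hp hqF]
  have hB := hπ.blockOf_mem hqF
  have hqB := hπ.mem_blockOf hqF
  by_cases hpB : (⟨p, by omega⟩ : Fin m) ∈ blockOf π q
  · exact ⟨⟨p, by omega⟩, fun h => h0 (by rw [← h]), by rw [b0]; exact hπ.eq_blockOf hB hpB⟩
  by_cases hp1B : (⟨p + 1, by omega⟩ : Fin m) ∈ blockOf π q
  · exact ⟨⟨p + 1, by omega⟩, fun h => h1 (by rw [← h]), by rw [b1]; exact hπ.eq_blockOf hB hp1B⟩
  have h2le := hg.2.1 _ hB hpB hp1B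
  obtain ⟨r, hr, hrq⟩ := Finset.exists_mem_ne h2le q
  refine ⟨r, hrq, ?_⟩
  have hrF : r ∈ freePos m p := hπ.subset hB hr
  rw [basePt_of_mem_freePos hp hrF]
  exact hπ.eq_blockOf hB hr

/-- The block of `mkWordP` sums to zero. [cite: MadrasSlade1993, Definition 1.2.4; lane lemma] -/
theorem bsumW_mkWordP (hp : p + 4 ≤ m) {π : Finset (Finset (Fin m))} (hπ : IsSetPartition (freePos m p) π) (S : Finset (Fin m)) :
    bsumW (mkWordP hp π S) p (p + 4) = 0 := by
  classical
  unfold bsumW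
  have ht : (Finset.univ.filter fun q : Fin m => p ≤ q.val ∧ q.val < p + 4) =
      ({⟨p, by omega⟩, ⟨p + 1, by omega⟩, ⟨p + 2, by omega⟩, ⟨p + 3, by omega⟩} : Finset (Fin m)) := by
    ext q
    simp only [Finset.mem_filter, Finset.mem_univ, true_and, Finset.mem_insert, Finset.mem_singleton, Fin.ext_iff]
    omega
  rw [ht, Finset.sum_insert (by simp [Fin.ext_iff]), Finset.sum_insert (by simp [Fin.ext_iff]),
    Finset.sum_pair (by simp [Fin.ext_iff])]
  obtain ⟨b2, b3, b0, b1⟩ := basePt_block hp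
  have hax2 : axisOfP hp π ⟨p + 2, by omega⟩ = axisOfP hp π ⟨p, by omega⟩ := by rw [axisOfP_eq_iff hp hπ, b2, b0]
  have hax3 : axisOfP hp π ⟨p + 3, by omega⟩ = axisOfP hp π ⟨p + 1, by omega⟩ := by rw [axisOfP_eq_iff hp hπ, b3, b1]
  have e2 : mkWordP hp π S ⟨p + 2, by omega⟩ = revIdx (mkWordP hp π S ⟨p, by omega⟩) := by
    unfold mkWordP revIdx
    refine Prod.ext hax2 ?_
    unfold signOf; simp
  have e3 : mkWordP hp π S ⟨p + 3, by omega⟩ = revIdx (mkWordP hp π S ⟨p + 1, by omega⟩) := by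
    unfold mkWordP revIdx
    refine Prod.ext hax3 ?_
    unfold signOf; simp
  rw [e2, e3, twoStepV_revIdx, twoStepV_revIdx]
  abel

/-- ★ THE BUILT WORD IS IN THE CLASS: `canon (mkWordP hp π S) ∈ shapeClass j m (topVec m p)` for every good partition `π` and sign set `S`.
[cite: MadrasSlade1993, Definition 1.2.4; lane lemma] -/
theorem canon_mkWordP_mem_shapeClass {j : ℕ} (hp : p + 4 ≤ m) {π : Finset (Finset (Fin m))} (hπ : IsSetPartition (freePos m p) π)
    (hg : GoodPart m j p hp π) (S : Finset (Fin m)) : canon (mkWordP hp π S) ∈ shapeClass j m (topVec m p) := by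
  classical
  have hst : SameType (mkWordP hp π S) (canon (mkWordP hp π S)) := sameType_canon _
  unfold shapeClass
  simp only [Finset.mem_filter, Finset.mem_univ, true_and]
  refine ⟨hst.symm.canon_eq, ?_, fun i => (hst.isRep_iff i).1 (isRep_mkWordP hp hπ hg S i), ?_, ?_⟩
  · rw [numAxes_canon, numAxes_mkWordP hp hπ S]; exact hg.2.2
  · -- run-wise reversal-free: consecutive block letters have different axes
    intro i hi hA heq
    have hax : (canon (mkWordP hp π S) ⟨i.val + 1, hi⟩).1 = (canon (mkWordP hp π S) i).1 := by rw [heq]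
    have hax' : (mkWordP hp π S i).1 = (mkWordP hp π S ⟨i.val + 1, hi⟩).1 := ((hst.1 i ⟨i.val + 1, hi⟩).2 hax.symm)
    change axisOfP hp π i = axisOfP hp π ⟨i.val + 1, hi⟩ at hax'
    rw [axisOfP_eq_iff hp hπ] at hax'
    rw [topVec_eq_true_iff] at hA
    obtain ⟨b2, b3, b0, b1⟩ := basePt_block hp
    have hi3 : i.val = p ∨ i.val = p + 1 ∨ i.val = p + 2 := by omega
    have hbase : ∀ (r : Fin m) (k : ℕ) (hk : k + 4 ≤ m + 3), r.val = k → k = p ∨ k = p + 1 ∨ k = p + 2 ∨ k = p + 3 →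
        basePt hp r = if k = p + 2 then ⟨p, by omega⟩ else if k = p + 3 then ⟨p + 1, by omega⟩ else r := by
      intro r k hk hrk hk'
      unfold basePt
      rw [hrk]
    rcases hi3 with h | h | h
    · have hb1 : basePt hp i = ⟨p, by omega⟩ := by
        rw [hbase i p (by omega) h (by omega), if_neg (by omega), if_neg (by omega)]; exact Fin.ext h
      have hb2 : basePt hp ⟨i.val + 1, hi⟩ = ⟨p + 1, by omega⟩ := by
        rw [hbase ⟨i.val + 1, hi⟩ (p + 1) (by omega) (by simp only; omega) (by omega), if_neg (by omega), if_neg (by omega)]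
        exact Fin.ext (by simp only; omega)
      rw [hb1, hb2] at hax'
      exact hg.1 hax'
    · have hb1 : basePt hp i = ⟨p + 1, by omega⟩ := by
        rw [hbase i (p + 1) (by omega) h (by omega), if_neg (by omega), if_neg (by omega)]; exact Fin.ext h
      have hb2 : basePt hp ⟨i.val + 1, hi⟩ = ⟨p, by omega⟩ := by
        rw [hbase ⟨i.val + 1, hi⟩ (p + 2) (by omega) (by simp only; omega) (by omega), if_pos rfl]
      rw [hb1, hb2] at hax'
      exact hg.1 hax'.symm
    · have hb1 : basePt hp i = ⟨p, by omega⟩ := by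
        rw [hbase i (p + 2) (by omega) h (by omega), if_pos rfl]
      have hb2 : basePt hp ⟨i.val + 1, hi⟩ = ⟨p + 1, by omega⟩ := by
        rw [hbase ⟨i.val + 1, hi⟩ (p + 3) (by omega) (by simp only; omega) (by omega), if_neg (by omega), if_pos rfl]
      rw [hb1, hb2] at hax'
      exact hg.1 hax'
  · refine ⟨p, p + 4, by omega, hp, fun k hk hk' => (topVec_eq_true_iff k).2 ⟨hk, by omega⟩, ?_⟩
    rw [wordPos_eq_iff_bsumW (canon (mkWordP hp π S)) (by omega) hp]
    have h0 := bsumW_mkWordP hp hπ S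
    unfold bsumW at h0 ⊢
    exact (hst.sum_eq_zero_iff _).1 h0

/-! ### The forgetful map: the partition of the free positions by axis, and the signs -/

open Classical in
/-- The axis partition of the free positions of a one-block shape. [cite: MadrasSlade1993, Definition 1.2.4; lane tool notion] -/
noncomputable def partOf (p : ℕ) (κ : Word m m) : Finset (Finset (Fin m)) := (freePos m p).image fun q => axCls κ q ∩ freePos m p

open Classical in
/-- `partOf κ` is a set partition of the free positions (for any word). [cite: MadrasSlade1993, Definition 1.2.4; lane lemma] -/
theorem isSetPartition_partOf (κ : Word m m) : IsSetPartition (freePos m p) (partOf p κ) := by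
  refine ⟨fun P hP => ?_, fun h => ?_, fun v hv => ⟨_, Finset.mem_image_of_mem _ hv, Finset.mem_inter.2 ⟨self_mem_axCls κ v, hv⟩⟩,
    fun P hP Q hQ v hvP hvQ => ?_⟩
  · obtain ⟨q, -, rfl⟩ := Finset.mem_image.1 hP; exact Finset.inter_subset_right
  · obtain ⟨q, hq, he⟩ := Finset.mem_image.1 h
    exact Finset.notMem_empty q (he ▸ Finset.mem_inter.2 ⟨self_mem_axCls κ q, hq⟩)
  · obtain ⟨a, -, rfl⟩ := Finset.mem_image.1 hP
    obtain ⟨b, -, rfl⟩ := Finset.mem_image.1 hQ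
    rw [← axCls_eq_of_mem (Finset.mem_inter.1 hvP).1, ← axCls_eq_of_mem (Finset.mem_inter.1 hvQ).1]

open Classical in
/-- The block of a free position `q` in `partOf κ` is `axCls κ q ∩ freePos`. [cite: MadrasSlade1993, Definition 1.2.4; lane plumbing] -/
theorem blockOf_partOf (κ : Word m m) {q : Fin m} (hq : q ∈ freePos m p) : blockOf (partOf p κ) q = axCls κ q ∩ freePos m p :=
  (isSetPartition_partOf κ).eq_blockOf (Finset.mem_image_of_mem _ hq) (Finset.mem_inter.2 ⟨self_mem_axCls κ q, hq⟩)

/-- In a one-block class the base point of `q` has the axis of `q`. [cite: MadrasSlade1993, Definition 1.2.4; lane plumbing] -/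
theorem axis_basePt {j : ℕ} {κ : Word m m} (hκ : κ ∈ shapeClass j m (topVec m p)) (hp : p + 4 ≤ m) (q : Fin m) :
    (κ (basePt hp q)).1 = (κ q).1 := by
  obtain ⟨h2, h3, -⟩ := top_block_general hκ hp
  unfold basePt
  split_ifs with e2 e3
  · have hq : q = ⟨p + 2, by omega⟩ := Fin.ext e2
    rw [hq, h2]
  · have hq : q = ⟨p + 3, by omega⟩ := Fin.ext e3
    rw [hq, h3]
  · rfl

open Classical in
/-- ★ The forgetful map lands in the block data. [cite: MadrasSlade1993, Definition 1.2.4; lane lemma] -/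
theorem partOf_signsOf_mem_blockData {j : ℕ} {κ : Word m m} (hκ : κ ∈ shapeClass j m (topVec m p)) (hp : p + 4 ≤ m) :
    (partOf p κ, signsOf p κ) ∈ blockData m j p hp := by
  unfold blockData goodParts
  rw [Finset.mem_product, Finset.mem_filter, mem_setPartitions]
  refine ⟨⟨isSetPartition_partOf κ, ?_, ?_, ?_⟩, Finset.mem_powerset.2 (Finset.filter_subset _ _)⟩
  · -- `p` and `p+1` lie in different blocks: their axes differ
    obtain ⟨-, -, hne⟩ := top_block_general hκ hp
    have hpF : (⟨p, by omega⟩ : Fin m) ∈ freePos m p := by unfold freePos; simp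
    have hp1F : (⟨p + 1, by omega⟩ : Fin m) ∈ freePos m p := by unfold freePos; simp
    rw [blockOf_partOf κ hpF, blockOf_partOf κ hp1F]
    intro h
    have : (⟨p + 1, by omega⟩ : Fin m) ∈ axCls κ ⟨p, by omega⟩ ∩ freePos m p := by
      rw [h]; exact Finset.mem_inter.2 ⟨self_mem_axCls κ _, hp1F⟩
    exact hne (mem_axCls.1 (Finset.mem_inter.1 this).1).symm
  · -- a block avoiding `p`, `p+1` has two elements: the repeat partner of its generator is free
    intro B hB hpB hp1B
    obtain ⟨q, hq, rfl⟩ := Finset.mem_image.1 hB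
    have hrep : IsRep κ q := by
      unfold shapeClass at hκ
      simp only [Finset.mem_filter, Finset.mem_univ, true_and] at hκ
      exact hκ.2.2.1 q
    obtain ⟨r, hrq, hr⟩ := hrep
    have hrF : r ∈ freePos m p := by
      by_contra hrF
      have hb := axis_basePt hκ hp r
      rw [hr] at hb
      -- `basePt r ∈ {p, p+1}` has the axis of `q`, so lies in the block
      have hbmem : basePt hp r ∈ axCls κ q ∩ freePos m p := Finset.mem_inter.2 ⟨mem_axCls.2 hb, basePt_mem_freePos hp r⟩
      unfold basePt at hbmem
      unfold freePos at hrF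
      rw [Finset.mem_filter, not_and, not_and_or, not_not, not_not] at hrF
      rcases hrF (Finset.mem_univ _) with h | h
      · rw [if_pos h] at hbmem; exact hpB hbmem
      · rw [if_neg (by omega), if_pos h] at hbmem; exact hp1B hbmem
    have h2 : ({q, r} : Finset (Fin m)) ⊆ axCls κ q ∩ freePos m p := by
      intro x hx
      rw [Finset.mem_insert, Finset.mem_singleton] at hx
      rcases hx with rfl | rfl
      · exact Finset.mem_inter.2 ⟨self_mem_axCls κ _, hq⟩
      · exact Finset.mem_inter.2 ⟨mem_axCls.2 hr, hrF⟩
    have := Finset.card_le_card h2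
    rwa [Finset.card_pair hrq.symm] at this
  · -- the number of blocks is the number of axes
    have hax : numAxes κ + j = m := by
      unfold shapeClass at hκ
      simp only [Finset.mem_filter, Finset.mem_univ, true_and] at hκ
      exact hκ.2.1
    suffices hcard : (partOf p κ).card = numAxes κ by change (partOf p κ).card + j = m; omega
    unfold partOf
    rw [numAxes_eq_card_image]
    -- both are the number of axis values attained on the free positions
    have hfull : (Finset.univ.image fun q : Fin m => (κ q).1) = (freePos m p).image fun q => (κ q).1 := by
      ext a
      simp only [Finset.mem_image, Finset.mem_univ, true_and]
      constructor
      · rintro ⟨q, rfl⟩; exact ⟨basePt hp q, basePt_mem_freePos hp q, axis_basePt hκ hp q⟩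
      · rintro ⟨q, -, rfl⟩; exact ⟨q, rfl⟩
    rw [hfull]
    -- `axCls κ q ∩ F` and `(κ q).1` induce the same equivalence on `F`
    refine Finset.card_nbij' (fun B => if h : ∃ q ∈ freePos m p, q ∈ B then (κ h.choose).1 else (κ ⟨p, by omega⟩).1)
      (fun a => (Finset.univ.filter fun r : Fin m => (κ r).1 = a) ∩ freePos m p) (fun B hB => ?_) (fun a ha => ?_) (fun B hB => ?_)
      (fun a ha => ?_)
    · obtain ⟨q, hq, rfl⟩ := Finset.mem_image.1 hB
      have hex : ∃ q' ∈ freePos m p, q' ∈ axCls κ q ∩ freePos m p := ⟨q, hq, Finset.mem_inter.2 ⟨self_mem_axCls κ q, hq⟩⟩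
      dsimp only
      rw [dif_pos hex]
      exact Finset.mem_image.2 ⟨hex.choose, hex.choose_spec.1, rfl⟩
    · obtain ⟨q, hq, rfl⟩ := Finset.mem_image.1 ha
      refine Finset.mem_image.2 ⟨q, hq, ?_⟩
      ext r; simp [axCls, Finset.mem_inter, Finset.mem_filter]
    · obtain ⟨q, hq, rfl⟩ := Finset.mem_image.1 hB
      have hex : ∃ q' ∈ freePos m p, q' ∈ axCls κ q ∩ freePos m p := ⟨q, hq, Finset.mem_inter.2 ⟨self_mem_axCls κ q, hq⟩⟩
      simp only [dif_pos hex]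
      have hc := (Finset.mem_inter.1 hex.choose_spec.2).1
      change axCls κ hex.choose ∩ freePos m p = axCls κ q ∩ freePos m p
      rw [axCls_eq_of_mem hc]
    · obtain ⟨q, hq, rfl⟩ := Finset.mem_image.1 ha
      have hex : ∃ q' ∈ freePos m p, q' ∈ (Finset.univ.filter fun r : Fin m => (κ r).1 = (κ q).1) ∩ freePos m p :=
        ⟨q, hq, Finset.mem_inter.2 ⟨Finset.mem_filter.2 ⟨Finset.mem_univ _, rfl⟩, hq⟩⟩
      simp only [dif_pos hex]
      have := (Finset.mem_filter.1 (Finset.mem_inter.1 hex.choose_spec.2).1).2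
      exact this

/-- ★ LEFT INVERSE: rebuilding from the axis partition and the signs gives the shape back. [cite: MadrasSlade1993, Definition 1.2.4; lane lemma] -/
theorem canon_mkWordP_partOf_signsOf {j : ℕ} {κ : Word m m} (hκ : κ ∈ shapeClass j m (topVec m p)) (hp : p + 4 ≤ m) :
    canon (mkWordP hp (partOf p κ) (signsOf p κ)) = κ := by
  classical
  have hcan : canon κ = κ := by
    unfold shapeClass at hκ
    simp only [Finset.mem_filter, Finset.mem_univ, true_and] at hκ
    exact hκ.1
  obtain ⟨h2, h3, -⟩ := top_block_general hκ hp
  have hπ := isSetPartition_partOf (p := p) κ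
  have hst : SameType (mkWordP hp (partOf p κ) (signsOf p κ)) κ := by
    refine ⟨fun q q' => ?_, fun q => ?_⟩
    · change axisOfP hp (partOf p κ) q = axisOfP hp (partOf p κ) q' ↔ _
      rw [axisOfP_eq_iff hp hπ, blockOf_partOf κ (basePt_mem_freePos hp q), blockOf_partOf κ (basePt_mem_freePos hp q'),
        ← axis_basePt hκ hp q, ← axis_basePt hκ hp q']
      constructor
      · intro h
        have : basePt hp q ∈ axCls κ (basePt hp q') ∩ freePos m p := by
          rw [← h]; exact Finset.mem_inter.2 ⟨self_mem_axCls κ _, basePt_mem_freePos hp q⟩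
        exact mem_axCls.1 (Finset.mem_inter.1 this).1
      · intro h
        rw [axCls_eq_of_mem (mem_axCls.2 h.symm)]
    · change signOf hp (signsOf p κ) q = (κ q).2
      unfold signOf signsOf freePos
      by_cases e2 : q.val = p + 2
      · rw [if_pos e2]
        have hq : q = ⟨p + 2, by omega⟩ := Fin.ext e2
        rw [hq, h2]
        simp
      · by_cases e3 : q.val = p + 3
        · rw [if_neg e2, if_pos e3]
          have hq : q = ⟨p + 3, by omega⟩ := Fin.ext e3
          rw [hq, h3]
          simp
        · rw [if_neg e2, if_neg e3]
          simp [e2, e3]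
  rw [hst.canon_eq, hcan]

/-- ★ RIGHT INVERSE: the partition and the sign set are read back off the built word. [cite: MadrasSlade1993, Definition 1.2.4; lane lemma] -/
theorem partOf_signsOf_canon_mkWordP {j : ℕ} (hp : p + 4 ≤ m) {d : Finset (Finset (Fin m)) × Finset (Fin m)} (hd : d ∈ blockData m j p hp) :
    (partOf p (canon (mkWordP hp d.1 d.2)), signsOf p (canon (mkWordP hp d.1 d.2))) = d := by
  classical
  obtain ⟨π, S⟩ := d
  unfold blockData goodParts at hd
  obtain ⟨hπ, hS⟩ := Finset.mem_product.1 hd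
  rw [Finset.mem_filter, mem_setPartitions] at hπ
  obtain ⟨hπ, -⟩ := hπ
  rw [Finset.mem_powerset] at hS
  refine Prod.ext ?_ ?_
  · simp only
    unfold partOf
    rw [Finset.image_congr (fun q _ => by rw [axCls_canon (mkWordP hp π S) q])]
    ext P
    rw [Finset.mem_image]
    have key : ∀ q ∈ freePos m p, axCls (mkWordP hp π S) q ∩ freePos m p = blockOf π q := by
      intro q hq
      rw [axCls_mkWordP hp hπ S q, basePt_of_mem_freePos hp hq]
      ext r
      simp only [Finset.mem_inter, Finset.mem_filter, Finset.mem_univ, true_and]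
      constructor
      · rintro ⟨h, hrF⟩
        rw [basePt_of_mem_freePos hp hrF] at h
        rw [← h]; exact hπ.mem_blockOf hrF
      · intro h
        have hrF : r ∈ freePos m p := hπ.subset (hπ.blockOf_mem hq) h
        refine ⟨?_, hrF⟩
        rw [basePt_of_mem_freePos hp hrF]
        exact hπ.eq_blockOf (hπ.blockOf_mem hq) h
    constructor
    · rintro ⟨q, hq, rfl⟩
      rw [key q hq]
      exact hπ.blockOf_mem hq
    · intro hP
      obtain ⟨v, hv⟩ := hπ.nonempty_of_mem hP
      have hvF : v ∈ freePos m p := hπ.subset hP hv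
      exact ⟨v, hvF, by rw [key v hvF, hπ.eq_blockOf hP hv]⟩
  · simp only
    unfold signsOf
    ext q
    rw [Finset.mem_filter]
    change q ∈ freePos m p ∧ signOf hp S q = true ↔ q ∈ S
    constructor
    · rintro ⟨hq, h⟩
      unfold freePos at hq
      rw [Finset.mem_filter] at hq
      unfold signOf at h
      rw [if_neg hq.2.1, if_neg hq.2.2] at h
      simpa using h
    · intro hq
      have hqf := hS hq
      refine ⟨hqf, ?_⟩
      unfold freePos at hqf
      rw [Finset.mem_filter] at hqf
      unfold signOf
      rw [if_neg hqf.2.1, if_neg hqf.2.2]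
      simpa using hq

/-- ★★ THE ONE-BLOCK SHAPE CLASS IS IN BIJECTION WITH THE BLOCK DATA: `#shapeClass j m (topVec m p) = #blockData m j p` for every `m`, `j`, `p + 4 ≤ m`.
[cite: MadrasSlade1993, Definition 1.2.4; lane theorem] -/
theorem card_shapeClass_topVec_eq_card_blockData {j : ℕ} (hp : p + 4 ≤ m) :
    (shapeClass j m (topVec m p)).card = (blockData m j p hp).card := by
  classical
  exact Finset.card_nbij' (fun κ => (partOf p κ, signsOf p κ)) (fun d => canon (mkWordP hp d.1 d.2))
    (fun κ hκ => partOf_signsOf_mem_blockData hκ hp)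
    (fun d hd => by
      unfold blockData goodParts at hd
      obtain ⟨hπ, -⟩ := Finset.mem_product.1 hd
      rw [Finset.mem_filter, mem_setPartitions] at hπ
      exact canon_mkWordP_mem_shapeClass hp hπ.1 hπ.2 d.2)
    (fun κ hκ => canon_mkWordP_partOf_signsOf hκ hp)
    (fun d hd => partOf_signsOf_canon_mkWordP hp hd)

/-- ★★★ THE ONE-BLOCK CLASS COUNT: `#shapeClass j m (topVec m p) = #goodParts m j p · 2^{m−2}` — a one-block shape class of ANY length `m` is
(a good set partition of the `m − 2` free positions by axis) × (free signs). λ3's `card_shapeClass_top` (`m = 2j`: the good partitions are the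
perfect matchings of the outside positions with `{p}`, `{p+1}` adjoined) is the first instance; the second-layer corner `m = 2j − 1` is the next.
[cite: MadrasSlade1993, Definition 1.2.4; lane theorem] -/
theorem card_shapeClass_topVec {j : ℕ} (hp : p + 4 ≤ m) :
    (shapeClass j m (topVec m p)).card = (goodParts m j p hp).card * 2 ^ (m - 2) := by
  classical
  rw [card_shapeClass_topVec_eq_card_blockData hp]
  unfold blockData
  rw [Finset.card_product, Finset.card_powerset, card_freePos hp]

end WordTypes

end Literature.Probability.RandomPlanarGeometry.SAW.Zd
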